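import Literature.AlgebraicGeometry.Resolution.ReesAwayPolynomial
import Literature.AlgebraicGeometry.Resolution.ExcellentRingsFieldProofs
import Literature.AlgebraicGeometry.Resolution.ExcellentRingsProofs
import Literature.RingTheory.HilbertSamuel.NormalFlatnessHilbertFunction
import HarnessLib

/-!
# The fibre cone `⊕ₙ 𝔭ⁿ/𝔫𝔭ⁿ` of an ideal of a local ring, its vertex, and the bound
# `H^{(0)}[(⊕ 𝔭ⁿ/𝔫𝔭ⁿ)_vertex](n) ≤ μ(𝔭ⁿ) ≤ H^{(0)}[𝒪_𝔭](n)` (normal flatness)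

Topic: `Literature/AlgebraicGeometry/Resolution`. For a Noetherian local ring `(𝒪, 𝔫, k)` and an
ideal `𝔭`, the scheme-theoretic fibre of the blowing up `Bl_𝔭(Spec 𝒪) → Spec 𝒪` over the closed
point is `Proj` of the FIBRE CONE `A = gr_𝔭(𝒪) ⊗_{𝒪/𝔭} k = ⊕ₙ 𝔭ⁿ/𝔫𝔭ⁿ = 𝒪[𝔭t]/𝔫𝒪[𝔭t]`
(Cossart–Jannsen–Saito, LNM 2270, proof of Thm. 3.10, p. 46: "let `A = gr_𝔭(𝒪_{X,x}) ⊗_{𝒪/𝔭} k(x)`,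
and let `F = π_X⁻¹(x) ⊂ X'` be the scheme theoretic fibre … Then `F = Proj(A)` … `C_{X,D,x} = Spec(A)`").
Hironaka's inequalities [H4, (4.1)] = CJS (3.14) compare the local ring of `X'` at a point of `F`
with the local ring of the cone `C_{X,D,x}` AT ITS VERTEX. This file DEFINES these objects on a copy
`ReesRing 𝔭` of Mathlib's Rees algebra `reesAlgebra 𝔭 = 𝒪[𝔭t] ⊆ 𝒪[t]` (a type synonym carrying ONE
commutative-ring structure, so that ideals, quotients and localizations of it elaborate along a
single instance path) and PROVES the one numerical fact about the vertex needed for Thm. 3.10 (1):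

* `ReesRing 𝔭` with `ReesRing.equiv : ReesRing 𝔭 ≃+* reesAlgebra 𝔭`, `ReesRing.poly`,
  `ReesRing.tMonomial 𝔭 n x hx = x tⁿ`, `ReesRing.constCoeff` (the augmentation);
  `reesMaxExt 𝔭 = 𝔫·𝒪[𝔭t]`; `reesVertex 𝔭 = 𝔫 ⊕ 𝒪[𝔭t]₊` (a maximal ideal);
  `reesVertex_pow_le` / `reesPowGen_le_reesVertex_pow` — **`(𝔫 ⊕ 𝒪[𝔭t]₊)ⁿ = 𝔫·(…) + (𝔭ⁿtⁿ)`**: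
  modulo `𝔫` the `n`-th power of the vertex ideal is generated by `𝔭ⁿ tⁿ`;
* `FibreCone 𝔭 = 𝒪[𝔭t]/𝔫𝒪[𝔭t]`, `fibreConeVertex 𝔭` (maximal), `FibreConeLocal 𝔭` = the local
  ring of the cone `Spec A` at its vertex, `fibreConeResidueMap : k → A`;
* **`hilbertFun_fibreConeLocal_le_spanFinrank`** — `H^{(0)}[A_vertex](n) ≤ μ(𝔭ⁿ)` (the `n`-th
  power of the maximal ideal of `A_vertex` is generated by the images of generators of `𝔭ⁿ`; in fact
  equality holds, `dim_k 𝔭ⁿ/𝔫𝔭ⁿ = μ(𝔭ⁿ)`, but only `≤` is used);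
* **`hilbertFun_fibreConeLocal_le_of_isNormallyFlat`** — if `𝔭` is prime and `𝒪` is normally flat
  along `𝔭` (CJS Def. 3.1: the `𝔭ⁱ/𝔭ⁱ⁺¹` are flat, hence free, over `𝒪/𝔭`) then
  `H^{(0)}[A_vertex] ≤ H^{(0)}[𝒪_𝔭]` (`μ(𝔭ⁿ) ≤ dim_{κ(𝔭)} 𝔭ⁿ𝒪_𝔭/𝔭ⁿ⁺¹𝒪_𝔭`,
  `spanFinrank_pow_le_hilbertFun_of_free`), and **`hilbertSamuelFun_fibreConeLocal_add_le`** — with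
  `𝒪/𝔭` regular of dimension `s` moreover `H^{(i+s)}[A_vertex] ≤ H^{(i)}[𝒪]` for all `i` (Bennett's
  inequality for the regular centre, HIO Prop. (30.1), `BennettRegularCentreDim.lean`). This is the
  equality "`H^{(1+s)}_{C_{X,D,x}} = H^{(1)}_{𝒪_{X,x}}`" of (3.14) in the inequality direction that
  Thm. 3.10 (1) consumes (HIO (31.1), display (8): Hironaka–Grothendieck
  `gr_𝔫(𝒪) ≅ (gr_𝔭(𝒪) ⊗ k)[T₁, …, T_s]` for permissible `𝔭`);
* `isGRing_fibreConeLocal` — `A_vertex` is a G-ring (essentially of finite type over the field `k`;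
  Stacks 07QW via `isQuasiExcellentRing_of_finiteType_field`), the input of Bennett's inequality
  (30.2) in `A`.

No named facts are introduced.

## Sources

* V. Cossart, U. Jannsen, S. Saito, *Desingularization: Invariants and Strategy*, LNM 2270
  (2020), Thm. 3.10 and its proof, (3.14) (p. 43–46); Def. 3.1. [CossartJannsenSaito2020]
* M. Herrmann, S. Ikeda, U. Orbanz, *Equimultiplicity and Blowing up*, Springer 1988, Ch. VI,
  Thm. (31.1) and its proof (displays (3), (8)), Cor. (31.2) (c). [HerrmannIkedaOrbanz1988]
* H. Hironaka, *Certain numerical characters of singularities*, J. Math. Kyoto Univ. 10 (1970),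
  (4.1) (= [H4] of CJS). Background.
-/

noncomputable section

open Polynomial IsLocalRing Literature.RingTheory.HilbertSamuel

namespace Literature.AlgebraicGeometry.Resolution

universe u

variable {O : Type u} [CommRing O]

/-! ## A copy of the Rees algebra with a single ring structure -/

/-- **The Rees algebra `𝒪[𝔭t]` of `𝔭`** as a type of its own: a copy of Mathlib's subalgebra
`reesAlgebra 𝔭 ⊆ 𝒪[t]`, carrying its commutative ring structure along exactly one instance path
(quotients and localizations of the subalgebra type itself meet competing `Semiring` instances).
[folklore] -/
def ReesRing (𝔭 : Ideal O) : Type u := reesAlgebra 𝔭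

namespace ReesRing

variable (𝔭 : Ideal O)

/-- The ring structure of `𝒪[𝔭t]` (that of the subalgebra of `𝒪[t]`). [folklore] -/
instance instCommRing : CommRing (ReesRing 𝔭) := inferInstanceAs (CommRing (reesAlgebra 𝔭))

/-- `𝒪[𝔭t]` is an `𝒪`-algebra. [folklore] -/
instance instAlgebra : Algebra O (ReesRing 𝔭) := inferInstanceAs (Algebra O (reesAlgebra 𝔭))

/-- `𝒪[𝔭t]` is Noetherian for Noetherian `𝒪`. [folklore] -/
instance instIsNoetherianRing [IsNoetherianRing O] : IsNoetherianRing (ReesRing 𝔭) :=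
  inferInstanceAs (IsNoetherianRing (reesAlgebra 𝔭))

/-- `𝒪[𝔭t]` is of finite type over Noetherian `𝒪`. [folklore] -/
instance instFiniteType [IsNoetherianRing O] : Algebra.FiniteType O (ReesRing 𝔭) :=
  inferInstanceAs (Algebra.FiniteType O (reesAlgebra 𝔭))

/-- The identity isomorphism with Mathlib's subalgebra `𝒪[𝔭t] ⊆ 𝒪[t]`. [folklore] -/
def equiv : ReesRing 𝔭 ≃+* reesAlgebra 𝔭 := RingEquiv.refl _

/-- The underlying polynomial of an element of `𝒪[𝔭t]`. [folklore] -/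
def poly (b : ReesRing 𝔭) : O[X] := ((equiv 𝔭 b : reesAlgebra 𝔭) : O[X])

/-- `poly` is injective. [folklore] -/
theorem poly_injective : Function.Injective (poly 𝔭) := fun _ _ h => Subtype.ext h

/-- Extensionality through polynomials. [folklore] -/
theorem ext {b c : ReesRing 𝔭} (h : poly 𝔭 b = poly 𝔭 c) : b = c := poly_injective 𝔭 h

/-- `poly` is additive. [folklore] -/
@[simp] theorem poly_add (b c : ReesRing 𝔭) : poly 𝔭 (b + c) = poly 𝔭 b + poly 𝔭 c := rfl
/-- `poly` is multiplicative. [folklore] -/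
@[simp] theorem poly_mul (b c : ReesRing 𝔭) : poly 𝔭 (b * c) = poly 𝔭 b * poly 𝔭 c := rfl
/-- `poly 0 = 0`. [folklore] -/
@[simp] theorem poly_zero : poly 𝔭 0 = 0 := rfl
/-- `poly 1 = 1`. [folklore] -/
@[simp] theorem poly_one : poly 𝔭 1 = 1 := rfl

/-- The coefficients of an element of `𝒪[𝔭t]` lie in the powers of `𝔭`. [folklore] -/
theorem coeff_poly_mem (b : ReesRing 𝔭) (i : ℕ) : (poly 𝔭 b).coeff i ∈ 𝔭 ^ i :=
  (mem_reesAlgebra_iff _ _).mp (equiv 𝔭 b).2 i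

/-- `poly (algebraMap r) = C r`. [folklore] -/
@[simp] theorem poly_algebraMap (r : O) :
    poly 𝔭 (algebraMap O (ReesRing 𝔭) r) = Polynomial.C r := rfl

/-- **The homogeneous element `x tⁿ ∈ 𝒪[𝔭t]`** for `x ∈ 𝔭ⁿ`. [folklore] -/
def tMonomial (n : ℕ) (x : O) (hx : x ∈ 𝔭 ^ n) : ReesRing 𝔭 :=
  (equiv 𝔭).symm ⟨monomial n x, reesAlgebra.monomial_mem.mpr hx⟩

/-- The polynomial of `x tⁿ` is the monomial `x Xⁿ`. [folklore] -/
@[simp] theorem poly_tMonomial (n : ℕ) (x : O) (hx : x ∈ 𝔭 ^ n) :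
    poly 𝔭 (tMonomial 𝔭 n x hx) = monomial n x := rfl

/-- `x t⁰ = x`. [folklore] -/
theorem tMonomial_zero (x : O) (hx : x ∈ 𝔭 ^ 0) :
    tMonomial 𝔭 0 x hx = algebraMap O (ReesRing 𝔭) x :=
  ext 𝔭 (by rw [poly_tMonomial, poly_algebraMap, monomial_zero_left])

/-- `x t¹` is the element `reesT x` of `AffineBlowup.lean`. [folklore] -/
theorem tMonomial_one (x : O) (hx : x ∈ 𝔭) (hx' : x ∈ 𝔭 ^ 1) :
    tMonomial 𝔭 1 x hx' = (equiv 𝔭).symm (reesT x hx) :=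
  ext 𝔭 rfl

/-- Additivity in `x`. [folklore] -/
theorem tMonomial_add (n : ℕ) (x y : O) (hx : x ∈ 𝔭 ^ n) (hy : y ∈ 𝔭 ^ n) :
    tMonomial 𝔭 n (x + y) (add_mem hx hy) = tMonomial 𝔭 n x hx + tMonomial 𝔭 n y hy :=
  ext 𝔭 (by rw [poly_add, poly_tMonomial, poly_tMonomial, poly_tMonomial, map_add])

/-- `𝒪`-linearity in `x`. [folklore] -/
theorem tMonomial_mul_left (n : ℕ) (c x : O) (hx : x ∈ 𝔭 ^ n) :
    tMonomial 𝔭 n (c * x) (Ideal.mul_mem_left _ c hx) =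
      algebraMap O (ReesRing 𝔭) c * tMonomial 𝔭 n x hx :=
  ext 𝔭 (by rw [poly_mul, poly_tMonomial, poly_tMonomial, poly_algebraMap, C_mul_monomial])

/-- Multiplicativity: `(x tᵐ)(y tⁿ) = (xy) tᵐ⁺ⁿ`. [folklore] -/
theorem tMonomial_mul (m n : ℕ) (x y : O) (hx : x ∈ 𝔭 ^ m) (hy : y ∈ 𝔭 ^ n) :
    tMonomial 𝔭 m x hx * tMonomial 𝔭 n y hy =
      tMonomial 𝔭 (m + n) (x * y) (by rw [pow_add]; exact Ideal.mul_mem_mul hx hy) :=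
  ext 𝔭 (by rw [poly_mul, poly_tMonomial, poly_tMonomial, poly_tMonomial, monomial_mul_monomial])

/-- A vanishing coefficient gives a vanishing monomial. [folklore] -/
theorem tMonomial_eq_zero {n : ℕ} {x : O} (hx : x ∈ 𝔭 ^ n) (h : x = 0) :
    tMonomial 𝔭 n x hx = 0 :=
  ext 𝔭 (by rw [poly_tMonomial, h, map_zero, poly_zero])

/-- **The augmentation `𝒪[𝔭t] → 𝒪`, `b ↦ b_0`.** [folklore] -/
def constCoeff : ReesRing 𝔭 →+* O := (reesConstCoeff 𝔭).comp (equiv 𝔭).toRingHom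

/-- The augmentation is the constant coefficient. [folklore] -/
@[simp] theorem constCoeff_apply (b : ReesRing 𝔭) : constCoeff 𝔭 b = (poly 𝔭 b).coeff 0 := rfl

/-- The augmentation of a constant. [folklore] -/
@[simp] theorem constCoeff_algebraMap (r : O) :
    constCoeff 𝔭 (algebraMap O (ReesRing 𝔭) r) = r := by
  rw [constCoeff_apply, poly_algebraMap, coeff_C_zero]

/-- The augmentation is surjective. [folklore] -/
theorem constCoeff_surjective : Function.Surjective (constCoeff 𝔭) :=
  fun r => ⟨algebraMap O (ReesRing 𝔭) r, constCoeff_algebraMap 𝔭 r⟩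

/-- `poly` as an additive monoid homomorphism. [folklore] -/
def polyAddHom : ReesRing 𝔭 →+ O[X] where
  toFun := poly 𝔭
  map_zero' := rfl
  map_add' := poly_add 𝔭

/-- `polyAddHom` is `poly`. [folklore] -/
@[simp] theorem polyAddHom_apply (b : ReesRing 𝔭) : polyAddHom 𝔭 b = poly 𝔭 b := rfl

/-- **Every element is the sum of its homogeneous components** `b = Σ_d b_d t^d`. [folklore] -/
theorem sum_tMonomial_coeff (b : ReesRing 𝔭) :
    ∑ d ∈ (poly 𝔭 b).support, tMonomial 𝔭 d ((poly 𝔭 b).coeff d) (coeff_poly_mem 𝔭 b d) = b := by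
  apply ext 𝔭
  rw [← polyAddHom_apply, map_sum]
  simp only [polyAddHom_apply, poly_tMonomial]
  exact (poly 𝔭 b).as_sum_support.symm

end ReesRing

/-! ## The vertex ideal of `𝒪[𝔭t]` and its powers -/

section Vertex

open ReesRing

variable (𝔭 : Ideal O)

/-- The ideal `(𝔭t) = 𝒪[𝔭t]₊` generated by the degree-one elements. [folklore] -/
def reesIrrel : Ideal (ReesRing 𝔭) :=
  Ideal.span (Set.range fun b : 𝔭 => tMonomial 𝔭 1 b.1 (by rw [pow_one]; exact b.2))

/-- The ideal `(𝔭ⁿ tⁿ)` generated by the homogeneous elements of degree `n`. [folklore] -/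
def reesPowGen (n : ℕ) : Ideal (ReesRing 𝔭) :=
  Ideal.span (Set.range fun x : ↥(𝔭 ^ n) => tMonomial 𝔭 n x.1 x.2)

/-- `x tⁿ` (`x ∈ 𝔭ⁿ`) lies in the `n`-th power of the ideal `(𝔭t)` (write `x` as a sum of products
of `n` elements of `𝔭`). [folklore] -/
theorem tMonomial_mem_reesIrrel_pow (n : ℕ) (x : O) (hx : x ∈ 𝔭 ^ n) :
    tMonomial 𝔭 n x hx ∈ reesIrrel 𝔭 ^ n := by
  induction n generalizing x with
  | zero => rw [pow_zero, Ideal.one_eq_top]; exact Submodule.mem_top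
  | succ n ih =>
    let S : Set O :=
      {x | ∃ hx : x ∈ 𝔭 ^ (n + 1), tMonomial 𝔭 (n + 1) x hx ∈ reesIrrel 𝔭 ^ (n + 1)}
    suffices h : x ∈ S by obtain ⟨_, h⟩ := h; exact h
    have hx' : x ∈ 𝔭 ^ n * 𝔭 := by rwa [← pow_succ]
    refine Submodule.mul_induction_on hx' (fun y hy z hz => ?_) (fun y z hy hz => ?_)
    · have hyz : y * z ∈ 𝔭 ^ (n + 1) := by rw [pow_succ]; exact Ideal.mul_mem_mul hy hz
      refine ⟨hyz, ?_⟩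
      have hz1 : z ∈ 𝔭 ^ 1 := by rwa [pow_one]
      rw [← tMonomial_mul 𝔭 n 1 y z hy hz1, pow_succ]
      exact Ideal.mul_mem_mul (ih y hy) (Ideal.subset_span ⟨⟨z, hz⟩, rfl⟩)
    · obtain ⟨hy', hy⟩ := hy
      obtain ⟨hz', hz⟩ := hz
      exact ⟨add_mem hy' hz', by rw [tMonomial_add 𝔭 (n + 1) y z hy' hz']; exact add_mem hy hz⟩

/-- **`(𝔭ⁿtⁿ) ⊆ (𝔭t)ⁿ`.** [folklore] -/
theorem reesPowGen_le_reesIrrel_pow (n : ℕ) : reesPowGen 𝔭 n ≤ reesIrrel 𝔭 ^ n := by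
  rw [reesPowGen, Ideal.span_le]
  rintro _ ⟨x, rfl⟩
  exact tMonomial_mem_reesIrrel_pow 𝔭 n x.1 x.2

/-- `(𝔭t) · (𝔭ⁿtⁿ) ⊆ (𝔭ⁿ⁺¹tⁿ⁺¹)`. [folklore] -/
theorem reesIrrel_mul_reesPowGen_le (n : ℕ) :
    reesIrrel 𝔭 * reesPowGen 𝔭 n ≤ reesPowGen 𝔭 (n + 1) := by
  rw [reesIrrel, reesPowGen, Ideal.span_mul_span', Ideal.span_le]
  rintro _ ⟨_, ⟨b, rfl⟩, _, ⟨x, rfl⟩, rfl⟩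
  have hb1 : (b : O) ∈ 𝔭 ^ 1 := by rw [pow_one]; exact b.2
  have hbx : (b : O) * x ∈ 𝔭 ^ (n + 1) := by rw [pow_succ']; exact Ideal.mul_mem_mul b.2 x.2
  have : tMonomial 𝔭 1 b.1 hb1 * tMonomial 𝔭 n x.1 x.2 = tMonomial 𝔭 (n + 1) (b * x) hbx := by
    rw [tMonomial_mul]
    exact ReesRing.ext 𝔭 (by rw [poly_tMonomial, poly_tMonomial, add_comm])
  change tMonomial 𝔭 1 b.1 hb1 * tMonomial 𝔭 n x.1 x.2 ∈ _
  rw [this]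
  exact Ideal.subset_span ⟨⟨_, hbx⟩, rfl⟩

/-- `(𝔭⁰t⁰) = 𝒪[𝔭t]`. [folklore] -/
theorem reesPowGen_zero : reesPowGen 𝔭 0 = ⊤ := by
  have h0 : (1 : O) ∈ 𝔭 ^ 0 := by rw [pow_zero, Ideal.one_eq_top]; exact Submodule.mem_top
  have h1 : tMonomial 𝔭 0 1 h0 = 1 :=
    ReesRing.ext 𝔭 (by rw [poly_tMonomial, monomial_zero_one, poly_one])
  have hmem : tMonomial 𝔭 0 1 h0 ∈ reesPowGen 𝔭 0 := Ideal.subset_span ⟨⟨1, h0⟩, rfl⟩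
  rw [h1] at hmem
  exact (Ideal.eq_top_iff_one _).mpr hmem

/-- `(𝔭ⁿtⁿ)` is generated by the `gᵢ tⁿ` for any generating set `{gᵢ}` of `𝔭ⁿ` (`x ↦ x tⁿ` is
`𝒪`-linear). [folklore] -/
theorem reesPowGen_eq_span_image (n : ℕ) {s : Set O} (hs : Ideal.span s = 𝔭 ^ n) :
    reesPowGen 𝔭 n =
      Ideal.span ((fun x : ↥(𝔭 ^ n) => tMonomial 𝔭 n x.1 x.2) ''
        {x : ↥(𝔭 ^ n) | (x : O) ∈ s}) := by
  refine le_antisymm ?_ (Ideal.span_mono (Set.image_subset_range _ _))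
  rw [reesPowGen, Ideal.span_le]
  rintro _ ⟨x, rfl⟩
  have hx : (x : O) ∈ Ideal.span s := by rw [hs]; exact x.2
  refine Submodule.span_induction (p := fun y _ => ∀ hy' : y ∈ 𝔭 ^ n,
      tMonomial 𝔭 n y hy' ∈ Ideal.span ((fun x : ↥(𝔭 ^ n) => tMonomial 𝔭 n x.1 x.2) ''
        {x : ↥(𝔭 ^ n) | (x : O) ∈ s})) ?_ ?_ ?_ ?_ hx x.2
  · intro y hy hy'
    exact Ideal.subset_span ⟨⟨y, hy'⟩, hy, rfl⟩
  · intro hy'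
    rw [tMonomial_eq_zero 𝔭 hy' rfl]; exact zero_mem _
  · intro y z hy hz ihy ihz hyz
    have hy' : y ∈ 𝔭 ^ n := hs ▸ hy
    have hz' : z ∈ 𝔭 ^ n := hs ▸ hz
    rw [show tMonomial 𝔭 n (y + z) hyz = tMonomial 𝔭 n y hy' + tMonomial 𝔭 n z hz' from
      tMonomial_add 𝔭 n y z hy' hz']
    exact add_mem (ihy hy') (ihz hz')
  · intro c y hy ihy hcy
    have hy' : y ∈ 𝔭 ^ n := hs ▸ hy
    rw [show tMonomial 𝔭 n (c • y) hcy = algebraMap O (ReesRing 𝔭) c * tMonomial 𝔭 n y hy'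
      from tMonomial_mul_left 𝔭 n c y hy']
    exact Ideal.mul_mem_left _ _ (ihy hy')

/-- An element of `𝒪[𝔭t]` with vanishing constant coefficient lies in `(𝔭t)`: its components
`b_d t^d`, `d ≥ 1`, lie in `(𝔭^d t^d) ⊆ (𝔭t)^d ⊆ (𝔭t)`. [folklore] -/
theorem mem_reesIrrel_of_constCoeff_eq_zero {b : ReesRing 𝔭} (hb : constCoeff 𝔭 b = 0) :
    b ∈ reesIrrel 𝔭 := by
  rw [← sum_tMonomial_coeff 𝔭 b]
  refine Ideal.sum_mem _ fun d _ => ?_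
  by_cases hd : d = 0
  · subst hd
    rw [constCoeff_apply] at hb
    rw [tMonomial_eq_zero 𝔭 _ hb]
    exact zero_mem _
  · have h := tMonomial_mem_reesIrrel_pow 𝔭 d ((poly 𝔭 b).coeff d) (coeff_poly_mem 𝔭 b d)
    exact Ideal.pow_le_self hd h

variable [IsLocalRing O]

/-- The extension `𝔫 · 𝒪[𝔭t]` of the maximal ideal of `𝒪` to the Rees algebra. [folklore] -/
def reesMaxExt : Ideal (ReesRing 𝔭) := (maximalIdeal O).map (algebraMap O (ReesRing 𝔭))

/-- **The vertex ideal `𝔫 ⊕ 𝒪[𝔭t]₊ ⊆ 𝒪[𝔭t]`**: the elements with constant coefficient in `𝔫`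
(the preimage of `𝔫` under the augmentation). Its image in the fibre cone `𝒪[𝔭t]/𝔫𝒪[𝔭t]` is the
irrelevant ideal, the vertex of the cone. [cite: CossartJannsenSaito2020, Thm. 3.10 (proof, p. 46)] -/
def reesVertex : Ideal (ReesRing 𝔭) := (maximalIdeal O).comap (constCoeff 𝔭)

/-- Membership in the vertex ideal. [folklore] -/
theorem mem_reesVertex_iff (b : ReesRing 𝔭) :
    b ∈ reesVertex 𝔭 ↔ (poly 𝔭 b).coeff 0 ∈ maximalIdeal O :=
  Iff.rfl

/-- The vertex ideal is maximal (`𝒪[𝔭t]/(𝔫 ⊕ 𝒪[𝔭t]₊) = k`). [folklore] -/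
instance isMaximal_reesVertex : (reesVertex 𝔭).IsMaximal :=
  Ideal.comap_isMaximal_of_surjective _ (constCoeff_surjective 𝔭)

/-- `𝔫 𝒪[𝔭t] ⊆ 𝔫 ⊕ 𝒪[𝔭t]₊`. [folklore] -/
theorem reesMaxExt_le_reesVertex : reesMaxExt 𝔭 ≤ reesVertex 𝔭 := by
  refine Ideal.map_le_iff_le_comap.mpr fun r hr => ?_
  change constCoeff 𝔭 (algebraMap O (ReesRing 𝔭) r) ∈ maximalIdeal O
  rwa [constCoeff_algebraMap]

/-- `(𝔭t) ⊆ 𝔫 ⊕ 𝒪[𝔭t]₊`. [folklore] -/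
theorem reesIrrel_le_reesVertex : reesIrrel 𝔭 ≤ reesVertex 𝔭 := by
  rw [reesIrrel, Ideal.span_le]
  rintro _ ⟨b, rfl⟩
  rw [SetLike.mem_coe, mem_reesVertex_iff, poly_tMonomial, coeff_monomial, if_neg one_ne_zero]
  exact zero_mem _

/-- **`𝔫 ⊕ 𝒪[𝔭t]₊ = 𝔫𝒪[𝔭t] + (𝔭t)`**: split off the constant coefficient. [folklore] -/
theorem reesVertex_eq_sup : reesVertex 𝔭 = reesMaxExt 𝔭 ⊔ reesIrrel 𝔭 := by
  refine le_antisymm (fun b hb => ?_)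
    (sup_le (reesMaxExt_le_reesVertex 𝔭) (reesIrrel_le_reesVertex 𝔭))
  -- `b = b_0 + (b - b_0)` with `b_0 ∈ 𝔫` and `b - b_0` without constant term
  have hsplit : b = algebraMap O (ReesRing 𝔭) (constCoeff 𝔭 b) +
      (b - algebraMap O (ReesRing 𝔭) (constCoeff 𝔭 b)) :=
    (add_sub_cancel _ _).symm
  rw [hsplit]
  refine add_mem (Ideal.mem_sup_left (Ideal.mem_map_of_mem _ hb)) (Ideal.mem_sup_right ?_)
  apply mem_reesIrrel_of_constCoeff_eq_zero
  rw [map_sub, constCoeff_algebraMap, sub_self]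

/-- **`(𝔫 ⊕ 𝒪[𝔭t]₊)ⁿ ⊆ 𝔫𝒪[𝔭t] + (𝔭ⁿtⁿ)`**: modulo `𝔫`, the powers of the vertex ideal are the
powers of the irrelevant ideal, generated by `𝔭ⁿ tⁿ`. [folklore] -/
theorem reesVertex_pow_le (n : ℕ) : reesVertex 𝔭 ^ n ≤ reesMaxExt 𝔭 ⊔ reesPowGen 𝔭 n := by
  induction n with
  | zero => rw [reesPowGen_zero, sup_top_eq]; exact le_top
  | succ n ih =>
    set E := reesMaxExt 𝔭
    calc reesVertex 𝔭 ^ (n + 1) = reesVertex 𝔭 * reesVertex 𝔭 ^ n := pow_succ' _ _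
      _ ≤ (E ⊔ reesIrrel 𝔭) * (E ⊔ reesPowGen 𝔭 n) :=
          Ideal.mul_mono (reesVertex_eq_sup 𝔭).le ih
      _ ≤ E ⊔ reesIrrel 𝔭 * reesPowGen 𝔭 n := by
          rw [Ideal.sup_mul, Ideal.mul_sup, Ideal.mul_sup]
          exact sup_le (sup_le (Ideal.mul_le_right.trans le_sup_left)
              (Ideal.mul_le_right.trans le_sup_left))
            (sup_le (Ideal.mul_le_left.trans le_sup_left) le_sup_right)
      _ ≤ E ⊔ reesPowGen 𝔭 (n + 1) := sup_le_sup_left (reesIrrel_mul_reesPowGen_le 𝔭 n) _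

/-- **`(𝔭ⁿ tⁿ) ⊆ (𝔫 ⊕ 𝒪[𝔭t]₊)ⁿ`.** [folklore] -/
theorem reesPowGen_le_reesVertex_pow (n : ℕ) : reesPowGen 𝔭 n ≤ reesVertex 𝔭 ^ n :=
  (reesPowGen_le_reesIrrel_pow 𝔭 n).trans (Ideal.pow_right_mono (reesIrrel_le_reesVertex 𝔭) n)

end Vertex

/-! ## The fibre cone `A = 𝒪[𝔭t]/𝔫𝒪[𝔭t] = ⊕ 𝔭ⁿ/𝔫𝔭ⁿ` and its local ring at the vertex -/

section Cone

open ReesRing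

variable [IsLocalRing O] (𝔭 : Ideal O)

/-- **The fibre cone** `A = gr_𝔭(𝒪) ⊗_{𝒪/𝔭} k = ⊕ₙ 𝔭ⁿ/𝔫𝔭ⁿ` of `𝔭` at the closed point, realised as
`𝒪[𝔭t]/𝔫𝒪[𝔭t]`; `Proj(A)` is the fibre of `Bl_𝔭 → Spec 𝒪` over the closed point and
`Spec(A) = C_{X,D,x}` is the cone over it. [cite: CossartJannsenSaito2020, Thm. 3.10 (proof, p. 46)] -/
abbrev FibreCone : Type u := ReesRing 𝔭 ⧸ reesMaxExt 𝔭

/-- **The vertex of the fibre cone**: the irrelevant ideal `A₊`, image of `𝔫 ⊕ 𝒪[𝔭t]₊`.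
[cite: CossartJannsenSaito2020, Thm. 3.10 (proof, p. 46)] -/
def fibreConeVertex : Ideal (FibreCone 𝔭) :=
  (reesVertex 𝔭).map (Ideal.Quotient.mk (reesMaxExt 𝔭))

/-- The preimage of the vertex in `𝒪[𝔭t]` is the vertex ideal `𝔫 ⊕ 𝒪[𝔭t]₊`. [folklore] -/
theorem comap_mk_fibreConeVertex :
    (fibreConeVertex 𝔭).comap (Ideal.Quotient.mk (reesMaxExt 𝔭)) = reesVertex 𝔭 := by
  rw [fibreConeVertex, Ideal.comap_map_of_surjective _ Ideal.Quotient.mk_surjective,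
    ← RingHom.ker_eq_comap_bot, Ideal.mk_ker, sup_eq_left]
  exact reesMaxExt_le_reesVertex 𝔭

/-- The vertex is a maximal ideal (`A/A₊ = k`). [folklore] -/
instance isMaximal_fibreConeVertex : (fibreConeVertex 𝔭).IsMaximal := by
  have hne : fibreConeVertex 𝔭 ≠ ⊤ := fun h => by
    have := comap_mk_fibreConeVertex 𝔭
    rw [h, Ideal.comap_top] at this
    exact (isMaximal_reesVertex 𝔭).ne_top this.symm
  rcases Ideal.map_eq_top_or_isMaximal_of_surjective (Ideal.Quotient.mk (reesMaxExt 𝔭))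
    Ideal.Quotient.mk_surjective (isMaximal_reesVertex 𝔭) with h | h
  · exact absurd h hne
  · exact h

/-- **The local ring of the fibre cone at its vertex** (the local ring of `C_{X,D,x} = Spec(A)` at
the origin, whose Hilbert function is "`H_{C_{X,D,x}}`" in CJS (3.14)).
[cite: CossartJannsenSaito2020, Thm. 3.10 (proof, (3.14))] -/
abbrev FibreConeLocal : Type u := Localization.AtPrime (fibreConeVertex 𝔭)

/-- The structure map `𝒪[𝔭t] → A_vertex`. [folklore] -/
def toFibreConeLocal : ReesRing 𝔭 →+* FibreConeLocal 𝔭 :=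
  (algebraMap (FibreCone 𝔭) (FibreConeLocal 𝔭)).comp (Ideal.Quotient.mk (reesMaxExt 𝔭))

/-- `𝒪[𝔭t] → A_vertex` is the algebra map. [folklore] -/
theorem toFibreConeLocal_eq_algebraMap :
    toFibreConeLocal 𝔭 = algebraMap (ReesRing 𝔭) (FibreConeLocal 𝔭) :=
  rfl

/-- `𝔫𝒪[𝔭t]` dies in `A_vertex`. [folklore] -/
theorem map_toFibreConeLocal_reesMaxExt : (reesMaxExt 𝔭).map (toFibreConeLocal 𝔭) = ⊥ := by
  rw [toFibreConeLocal, ← Ideal.map_map, Ideal.map_quotient_self, Ideal.map_bot]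

/-- The maximal ideal of `A_vertex` is the extension of the vertex ideal of `𝒪[𝔭t]`. [folklore] -/
theorem maximalIdeal_fibreConeLocal_eq :
    maximalIdeal (FibreConeLocal 𝔭) = (reesVertex 𝔭).map (toFibreConeLocal 𝔭) := by
  rw [toFibreConeLocal, ← Ideal.map_map, ← fibreConeVertex, Localization.AtPrime.map_eq_maximalIdeal]

/-- **The powers of the maximal ideal of `A_vertex` are generated by `𝔭ⁿ tⁿ`**:
`𝔪ⁿ_{A_vertex} = (𝔭ⁿtⁿ) · A_vertex`. [cite: CossartJannsenSaito2020, Thm. 3.10 (proof, p. 46)] -/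
theorem maximalIdeal_fibreConeLocal_pow (n : ℕ) :
    maximalIdeal (FibreConeLocal 𝔭) ^ n = (reesPowGen 𝔭 n).map (toFibreConeLocal 𝔭) := by
  rw [maximalIdeal_fibreConeLocal_eq, ← Ideal.map_pow]
  refine le_antisymm ?_ (Ideal.map_mono (reesPowGen_le_reesVertex_pow 𝔭 n))
  refine (Ideal.map_mono (reesVertex_pow_le 𝔭 n)).trans ?_
  rw [Ideal.map_sup, map_toFibreConeLocal_reesMaxExt, bot_sup_eq]

variable [IsNoetherianRing O]

/-- **`H^{(0)}[A_vertex](n) ≤ μ(𝔭ⁿ)`**: the `n`-th power of the maximal ideal of the local ring of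
the fibre cone at its vertex is generated by the images of any set of generators of `𝔭ⁿ`
(in fact `H^{(0)}[A_vertex](n) = dim_k 𝔭ⁿ/𝔫𝔭ⁿ = μ(𝔭ⁿ)`; only the inequality is recorded).
[cite: CossartJannsenSaito2020, Thm. 3.10 (proof, (3.14))]
[cite: HerrmannIkedaOrbanz1988, Thm. (31.1) (proof, (3))] -/
theorem hilbertFun_fibreConeLocal_le_spanFinrank (n : ℕ) :
    hilbertFun (FibreConeLocal 𝔭) n ≤ (𝔭 ^ n).spanFinrank := by
  classical
  rw [hilbertFun_eq_spanFinrank_pow, maximalIdeal_fibreConeLocal_pow]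
  obtain ⟨s, hscard, hsspan⟩ :=
    Submodule.FG.exists_span_finset_card_eq_spanFinrank (𝔭 ^ n).fg_of_isNoetherianRing
  have hsspan' : Ideal.span (s : Set O) = 𝔭 ^ n := hsspan
  rw [reesPowGen_eq_span_image 𝔭 n hsspan', Ideal.map_span, ← Set.image_comp]
  have hfin : ({x : ↥(𝔭 ^ n) | (x : O) ∈ s} : Set ↥(𝔭 ^ n)).Finite :=
    Set.Finite.of_injOn (f := fun x : ↥(𝔭 ^ n) => (x : O)) (fun x hx => Finset.mem_coe.mpr hx)
      Subtype.coe_injective.injOn s.finite_toSet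
  refine (Submodule.spanFinrank_span_le_ncard_of_finite (hfin.image _)).trans ?_
  refine (Set.ncard_image_le hfin).trans ?_
  rw [← hscard, ← Set.ncard_coe_finset]
  exact Set.ncard_le_ncard_of_injOn (fun x : ↥(𝔭 ^ n) => (x : O)) (fun x hx => hx)
    Subtype.coe_injective.injOn s.finite_toSet

/-- **Normal flatness: `H^{(0)}[A_vertex] ≤ H^{(0)}[𝒪_𝔭]`.** If `𝔭` is prime and every
`𝔭ⁱ/𝔭ⁱ⁺¹` is flat over `𝒪/𝔭` (CJS Def. 3.1 (1)), then the graded pieces are free (finite flat modules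
over the local ring `𝒪/𝔭`) and `μ(𝔭ⁿ) ≤ H^{(0)}[𝒪_𝔭](n)` (`spanFinrank_pow_le_hilbertFun_of_free`).
[cite: CossartJannsenSaito2020, Thm. 3.3, Thm. 3.10 (proof, (3.14))]
[cite: HerrmannIkedaOrbanz1988, Thm. (31.1) (proof, (8))] -/
theorem hilbertFun_fibreConeLocal_le_of_isNormallyFlat [𝔭.IsPrime] (Rp : Type u) [CommRing Rp]
    [Algebra O Rp] [IsLocalization.AtPrime Rp 𝔭] [IsLocalRing Rp] (hNF : 𝔭.IsNormallyFlat) :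
    hilbertFun (FibreConeLocal 𝔭) ≤ hilbertFun Rp := by
  intro n
  haveI := hNF n
  haveI : IsLocalRing (O ⧸ 𝔭) :=
    IsLocalRing.of_surjective' (Ideal.Quotient.mk 𝔭) Ideal.Quotient.mk_surjective
  haveI : Module.Finite (O ⧸ 𝔭) (gradedPiece 𝔭 n) := Module.Finite.of_restrictScalars_finite O _ _
  haveI : Module.Free (O ⧸ 𝔭) (gradedPiece 𝔭 n) := Module.free_of_flat_of_isLocalRing
  exact (hilbertFun_fibreConeLocal_le_spanFinrank 𝔭 n).trans
    (spanFinrank_pow_le_hilbertFun_of_free 𝔭 Rp n)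

/-- **`H^{(i+s)}[A_vertex] ≤ H^{(i)}[𝒪]` along a permissible centre** (`𝒪/𝔭` regular of dimension
`s`, `𝒪` normally flat along `𝔭`): combine the previous bound with Bennett's inequality for the
regular centre `H^{(i+s)}[𝒪_𝔭] ≤ H^{(i)}[𝒪]` (HIO Prop. (30.1)). This is the inequality direction of
"`H^{(1+s)}_{C_{X,D,x}} = H^{(1)}_{𝒪_{X,x}}`" in CJS (3.14) / HIO (31.1) (8).
[cite: CossartJannsenSaito2020, Thm. 3.10 (proof, (3.14))]
[cite: HerrmannIkedaOrbanz1988, Cor. (31.2) (c) (proof)] -/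
theorem hilbertSamuelFun_fibreConeLocal_add_le [𝔭.IsPrime] [IsRegularLocalRing (O ⧸ 𝔭)] {s : ℕ}
    (hs : ringKrullDim (O ⧸ 𝔭) = s) (hNF : 𝔭.IsNormallyFlat) (i : ℕ) :
    hilbertSamuelFun (FibreConeLocal 𝔭) (i + s) ≤ hilbertSamuelFun O i := by
  have h1 : hilbertSamuelFun (FibreConeLocal 𝔭) (i + s) ≤
      hilbertSamuelFun (Localization.AtPrime 𝔭) (i + s) :=
    iterPSum_mono (i + s)
      (hilbertFun_fibreConeLocal_le_of_isNormallyFlat 𝔭 (Localization.AtPrime 𝔭) hNF)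
  exact h1.trans
    (hilbertSamuelFun_add_le_of_isRegularLocalRing_quotient s 𝔭 (Localization.AtPrime 𝔭) hs i)

/-! ## The fibre cone is of finite type over the residue field (so its local rings are G-rings) -/

omit [IsNoetherianRing O] in
/-- The residue field maps to the fibre cone: `k = 𝒪/𝔫 → 𝒪[𝔭t]/𝔫𝒪[𝔭t]`. [folklore] -/
def fibreConeResidueMap : ResidueField O →+* FibreCone 𝔭 :=
  Ideal.Quotient.lift (maximalIdeal O)
    ((Ideal.Quotient.mk (reesMaxExt 𝔭)).comp (algebraMap O (ReesRing 𝔭)))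
    fun a ha => by
      rw [RingHom.comp_apply, Ideal.Quotient.eq_zero_iff_mem]
      exact Ideal.mem_map_of_mem _ ha

omit [IsNoetherianRing O] in
/-- Compatibility `k → A` with `𝒪 → 𝒪[𝔭t] → A`. [folklore] -/
theorem fibreConeResidueMap_residue (r : O) :
    fibreConeResidueMap 𝔭 (residue O r) =
      Ideal.Quotient.mk (reesMaxExt 𝔭) (algebraMap O (ReesRing 𝔭) r) := rfl

/-- **The local ring of the fibre cone at its vertex is a G-ring** (a localization of an algebra of
finite type over the field `k`, which is quasi-excellent, Stacks 07QW). This is the "excellence"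
hypothesis of Bennett's inequality (HIO Thm. (30.2)) for the cone `A`.
[cite: HerrmannIkedaOrbanz1988, Thm. (31.1) (proof, (6))] -/
theorem isGRing_fibreConeLocal : IsGRing (FibreConeLocal 𝔭) := by
  letI : Algebra (ResidueField O) (FibreCone 𝔭) := (fibreConeResidueMap 𝔭).toAlgebra
  haveI : IsScalarTower O (ResidueField O) (FibreCone 𝔭) :=
    IsScalarTower.of_algebraMap_eq fun r => rfl
  haveI : Algebra.FiniteType (ResidueField O) (FibreCone 𝔭) :=
    Algebra.FiniteType.of_restrictScalars_finiteType O (ResidueField O) (FibreCone 𝔭)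
  have hA : IsGRing (FibreCone 𝔭) :=
    (isQuasiExcellentRing_of_finiteType_field (ResidueField O) (FibreCone 𝔭)).isGRing
  exact isGRing_of_isLocalization (fibreConeVertex 𝔭).primeCompl hA

omit [IsNoetherianRing O] in
/-- `A_vertex` contains the field `k`. [folklore] -/
def fibreConeLocalResidueMap : ResidueField O →+* FibreConeLocal 𝔭 :=
  (algebraMap (FibreCone 𝔭) (FibreConeLocal 𝔭)).comp (fibreConeResidueMap 𝔭)

end Cone

end Literature.AlgebraicGeometry.Resolution

end
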